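import Literature.Computability.AlgebraicComplexity.BILPS19KoszulFlatteningProofs
import Literature.Computability.AlgebraicComplexity.DM16NonCommutativeRank
import Mathlib.LinearAlgebra.Matrix.Transvection
import Mathlib.LinearAlgebra.Vandermonde
import Mathlib.LinearAlgebra.Matrix.Nondegenerate
import HarnessLib

/-!
# `GL`-invariance of Koszul-flattening ranks, the general-position full-rank criterion, and a
# second (conceptual) proof of [DM16, Prop 4.6] = [Landsberg 2015]

Infrastructure file (theorem-only, 0 named facts) continuing `BILPS19KoszulFlatteningProofs.lean`
(BILPS §7.2 Koszul flattenings `F_{T,p} = Σ_i L_{e_i} ⊗ A_i`, `koszulMatrix p T`):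

* `rank_koszulMatrix_glAction` — **the rank of `F_{T,p}` is invariant under `GL` of the wedged
  factor** (`T_l ↦ Σ_j g_{lj} T_j`, `det g ≠ 0`, `p ≥ 1`). This is the matrix form of the
  functoriality `Λ^{p+1}(g) ∘ L_v ∘ Λ^p(g)⁻¹ = L_{gv}` WITHOUT building `Λ^p(g)`: Mathlib's
  transvection–diagonal–transvection decomposition (`Matrix.diagonal_transvection_induction_of_det_ne_zero`)
  reduces to shears (the intertwiner `rank_koszulMatrix_shear` of the BILPS file) and diagonal
  matrices (`diagonal_prod_mul_extMulMatrix`: `Λ(diag d) e_S = (∏_{s∈S} d_s) e_S`).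
* `rank_koszulMatrix_rankOne` — **Landsberg–Ottaviani's general-position criterion in coordinates**:
  for `2p+1` distinct `α_l`, the Koszul flattening `Σ_l L_{e_l} ⊗ v_l w_lᵀ` of the rank-`(2p+1)`
  tensor with Vandermonde legs `v_l = (α_l^d)_d`, `w_l = (α_l^{p-b})_b` is injective: the `e_T`-row
  block only involves the `p+1` independent vectors `v_l`, `l ∈ T`; then for each `p`-set `S` the
  `p+1` independent `w_l`, `l ∉ S`, force `z(S,·) = 0` (two Vandermonde steps,
  `vandermonde_vecMul_eq_zero_of_injOn` / `vandermonde_mulVec_eq_zero_of_injOn`).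
* `DerksenMakam2018_prop_4_6_viaKoszul` — corollary: a SECOND proof, in characteristic `0`, of
  [DM16, Prop 4.6] (Derksen–Makam, arXiv:1606.06701, p0009:L66–74, quoting [Landsberg, JPAA 219
  (2015)]): `landsbergMatrix K p` is the `p`-th Koszul flattening of the polynomial-multiplication
  tensor `t_{i,b,d} = [d + p = b + i]` (`landsbergMatrix_eq_koszulMatrix`); interpolation at the
  points `α_l = l` (`Σ_i α_l^i t_{i,b,d} = α_l^d α_l^{p-b}`, `vandermondeAction_toeplitz`) is the
  Vandermonde change of basis of the first factor, after which the criterion applies. The named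
  fact `DerksenMakam2018_prop_4_6` itself is ALREADY DISCHARGED in the tree by the
  unique-perfect-matching proof of `DM16LandsbergMatrixProofs.lean` (`DerksenMakam2018_prop_4_6_holds`,
  every field, p470411); this file does not restate it and exists for the two reusable theorems
  above (border-rank / Koszul–Young flattening rows: BILPS §7, `BorderRankCWKoszul*`, EGOW §6).

Honest framing (val-lit, NP corpus): linear algebra of explicit matrices; nothing here bears on
`VP ≠ VNP`, which is NOT proved.
-/

noncomputable section

namespace Literature.Computability.AlgebraicComplexity

open Matrix
open scoped Kronecker

section GLAction

variable {F : Type*} [Field F] {k m n : ℕ}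

/-- **Diagonal intertwiner**: `Λ^{q+1}(diag d) ∘ L_{e_j} = d_j · L_{e_j} ∘ Λ^q(diag d)` with
`Λ^q(diag d) e_S = (∏_{s ∈ S} d_s) e_S`. [cite: DerksenMakam2018, Prop 4.6 (proof)] -/
theorem diagonal_prod_mul_extMulMatrix (q : ℕ) (d : Fin k → F) (j : Fin k) :
    Matrix.diagonal (fun T : ExtIdx k (q + 1) => ∏ t ∈ T.1, d t) * extMulMatrix F k q j =
      d j • (extMulMatrix F k q j * Matrix.diagonal (fun S : ExtIdx k q => ∏ s ∈ S.1, d s)) := by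
  ext T S
  rw [Matrix.diagonal_mul, Matrix.smul_apply, Matrix.mul_diagonal, extMulMatrix_apply, smul_eq_mul]
  by_cases h : T.1 = insert j S.1
  · rw [if_pos h, h, Finset.prod_insert (not_mem_of_eq_insert h)]
    ring
  · rw [if_neg h, mul_zero, zero_mul, mul_zero]

/-- Rank invariance of the Koszul flattening under a diagonal change of basis of the first factor
(`T_l ↦ d_l T_l`, all `d_l ≠ 0`). [cite: DerksenMakam2018, Prop 4.6 (proof)] -/
theorem rank_koszulMatrix_diagonalAction (p : ℕ) (T : Fin k → Fin m → Fin n → F) {d : Fin k → F}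
    (hd : ∀ l, d l ≠ 0) :
    (koszulMatrix p (fun l b c => d l * T l b c)).rank = (koszulMatrix p T).rank := by
  have hconj : (Matrix.diagonal (fun T : ExtIdx k (p + 1) => ∏ t ∈ T.1, d t) ⊗ₖ
      (1 : Matrix (Fin n) (Fin n) F)) * koszulMatrix p T =
      koszulMatrix p (fun l b c => d l * T l b c) *
        (Matrix.diagonal (fun S : ExtIdx k p => ∏ s ∈ S.1, d s) ⊗ₖ (1 : Matrix (Fin m) (Fin m) F)) := by
    rw [koszulMatrix_eq_sum_kronecker, koszulMatrix_eq_sum_kronecker, Matrix.mul_sum, Matrix.sum_mul]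
    refine Finset.sum_congr rfl fun l _ => ?_
    have hA : (Matrix.of fun c b => d l * T l b c) = d l • Matrix.of (fun c b => T l b c) := by
      ext c b
      rfl
    rw [← Matrix.mul_kronecker_mul, diagonal_prod_mul_extMulMatrix, Matrix.one_mul, hA,
      Matrix.smul_kronecker, ← Matrix.kronecker_smul, ← Matrix.mul_kronecker_mul, Matrix.mul_one]
  have hu' : IsUnit ((Matrix.diagonal (fun T : ExtIdx k (p + 1) => ∏ t ∈ T.1, d t) ⊗ₖ
      (1 : Matrix (Fin n) (Fin n) F))).det := by
    rw [Matrix.det_kronecker, Matrix.det_one, one_pow, mul_one, Matrix.det_diagonal]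
    exact ((Finset.prod_ne_zero_iff.2 fun T _ =>
      Finset.prod_ne_zero_iff.2 fun t _ => hd t).isUnit).pow _
  have hu : IsUnit ((Matrix.diagonal (fun S : ExtIdx k p => ∏ s ∈ S.1, d s) ⊗ₖ
      (1 : Matrix (Fin m) (Fin m) F))).det := by
    rw [Matrix.det_kronecker, Matrix.det_one, one_pow, mul_one, Matrix.det_diagonal]
    exact ((Finset.prod_ne_zero_iff.2 fun S _ =>
      Finset.prod_ne_zero_iff.2 fun s _ => hd s).isUnit).pow _
  rw [← Matrix.rank_mul_eq_right_of_isUnit_det _ (koszulMatrix p T) hu', hconj,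
    Matrix.rank_mul_eq_left_of_isUnit_det _ _ hu]

/-- The action of `g ∈ GL(A)` on the first factor is associative:
`(A B) · T = A · (B · T)`. [cite: DerksenMakam2018, Prop 4.6 (proof)] -/
theorem glAction_mul (A B : Matrix (Fin k) (Fin k) F) (T : Fin k → Fin m → Fin n → F) :
    (fun l b c => ∑ j, (A * B) l j * T j b c) =
      fun l b c => ∑ j, A l j * (∑ i, B j i * T i b c) := by
  funext l b c
  simp only [Matrix.mul_apply, Finset.sum_mul, Finset.mul_sum]
  rw [Finset.sum_comm]
  refine Finset.sum_congr rfl fun i _ => Finset.sum_congr rfl fun j _ => ?_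
  ring

/-- **Rank invariance of the Koszul flattening under `GL` of the wedged factor** (`p ≥ 1`):
`rk F_{g·T,p} = rk F_{T,p}` for `det g ≠ 0`, by the transvection–diagonal–transvection
decomposition of `g`. [cite: DerksenMakam2018, Prop 4.6 (proof)] -/
theorem rank_koszulMatrix_glAction (p : ℕ) {g : Matrix (Fin k) (Fin k) F} (hg : g.det ≠ 0)
    (T : Fin k → Fin m → Fin n → F) :
    (koszulMatrix (p + 1) (fun l b c => ∑ j, g l j * T j b c)).rank =
      (koszulMatrix (p + 1) T).rank := by
  revert T
  refine Matrix.diagonal_transvection_induction_of_det_ne_zero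
    (fun g : Matrix (Fin k) (Fin k) F => ∀ T : Fin k → Fin m → Fin n → F,
      (koszulMatrix (p + 1) (fun l b c => ∑ j, g l j * T j b c)).rank =
        (koszulMatrix (p + 1) T).rank) g hg ?_ ?_ ?_
  · intro D hD T
    have hD' : ∀ l, D l ≠ 0 := by
      rw [Matrix.det_diagonal] at hD
      exact fun l h0 => hD (Finset.prod_eq_zero (Finset.mem_univ l) h0)
    have h : (fun l b c => ∑ j, Matrix.diagonal D l j * T j b c) = fun l b c => D l * T l b c := by
      funext l b c
      rw [Finset.sum_eq_single l (fun j _ hj => by rw [Matrix.diagonal_apply_ne _ (Ne.symm hj),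
        zero_mul]) (fun h => absurd (Finset.mem_univ l) h), Matrix.diagonal_apply_eq]
    rw [h]
    exact rank_koszulMatrix_diagonalAction (p + 1) T hD'
  · intro t T
    have h : (fun l b c => ∑ j, t.toMatrix l j * T j b c) =
        fun l b c => T l b c + if l = t.i then ∑ j, (Pi.single t.j t.c : Fin k → F) j * T j b c
          else 0 := by
      funext l b c
      have h1 : ∀ j, t.toMatrix l j =
          (if l = j then 1 else 0) + (if t.i = l ∧ t.j = j then t.c else 0) := by
        intro j
        simp only [TransvectionStruct.toMatrix, Matrix.transvection, Matrix.add_apply,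
          Matrix.one_apply, Matrix.single, Matrix.of_apply]
      simp_rw [h1, add_mul, Finset.sum_add_distrib, ite_mul, one_mul, zero_mul, Finset.sum_ite_eq,
        Finset.mem_univ, if_true]
      congr 1
      by_cases hl : l = t.i
      · subst hl
        simp only [true_and, if_true]
        rw [Finset.sum_ite_eq, if_pos (Finset.mem_univ _), Finset.sum_eq_single t.j
          (fun j _ hj => by rw [Pi.single_eq_of_ne hj, zero_mul])
          (fun h => absurd (Finset.mem_univ _) h), Pi.single_eq_same]
      · have h2 : ∀ j, ¬(t.i = l ∧ t.j = j) := fun j h => hl h.1.symm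
        simp only [h2, if_false, Finset.sum_const_zero, hl]
    rw [h]
    exact (rank_koszulMatrix_shear p T t.i (c := (Pi.single t.j t.c : Fin k → F))
      (Pi.single_eq_of_ne t.hij _)).symm
  · intro A B _ _ hA hB T
    rw [glAction_mul, hA, hB]

end GLAction

section Landsberg

variable {K : Type*} [Field K]

/-- Landsberg's matrix is the `p`-th Koszul flattening (BILPS §7.2) of the polynomial-multiplication
tensor `t_{i,b,d} = [d + p = b + i]`. [cite: DerksenMakam2018, Prop 4.6] -/
theorem landsbergMatrix_eq_koszulMatrix (p : ℕ) :
    landsbergMatrix K p = koszulMatrix p (fun i b d => toeplitzShift K p i d b) := by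
  rw [koszulMatrix_eq_sum_kronecker]
  rfl

/-- Interpolation: `Σ_i α^i [d + p = b + i] = α^d · α^{p-b}` (`b, d ≤ p`).
[cite: DerksenMakam2018, Prop 4.6 (proof)] -/
theorem sum_pow_mul_toeplitzShift (p : ℕ) (α : K) (b d : Fin (p + 1)) :
    ∑ i : Fin (2 * p + 1), α ^ (i : ℕ) * toeplitzShift K p i d b =
      α ^ (d : ℕ) * α ^ (p - (b : ℕ)) := by
  have hb := b.2
  have hd := d.2
  let i₀ : Fin (2 * p + 1) := ⟨(d : ℕ) + p - b, by omega⟩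
  rw [Finset.sum_eq_single i₀]
  · have h : ((d : ℕ) + p = b + ((d : ℕ) + p - b)) := by omega
    simp only [toeplitzShift, Matrix.of_apply, i₀]
    rw [if_pos h, mul_one, ← pow_add]
    congr 1
    omega
  · intro i _ hi
    simp only [toeplitzShift, Matrix.of_apply]
    rw [if_neg, mul_zero]
    intro h
    apply hi
    apply Fin.ext
    simp only [i₀]
    omega
  · exact fun h => absurd (Finset.mem_univ _) h

/-- After the Vandermonde change of basis `V = (α_l^i)` of the first factor, every slice of the
polynomial-multiplication tensor is rank one: `(V·t)_{l,b,d} = α_l^d α_l^{p-b}`.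
[cite: DerksenMakam2018, Prop 4.6 (proof)] -/
theorem vandermondeAction_toeplitz (p : ℕ) (α : Fin (2 * p + 1) → K) :
    (fun l (b d : Fin (p + 1)) => ∑ i, Matrix.vandermonde α l i * toeplitzShift K p i d b) =
      fun l (b d : Fin (p + 1)) => α l ^ (d : ℕ) * α l ^ (p - (b : ℕ)) := by
  funext l b d
  simp only [Matrix.vandermonde_apply]
  exact sum_pow_mul_toeplitzShift p (α l) b d

/-- Single nonzero term of `Σ_S L_{e_l}(T,S) f(S)`: zero if `l ∉ T`.
[cite: DerksenMakam2018, Prop 4.6 (proof)] -/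
theorem sum_extMulMatrix_mul_of_not_mem {k q : ℕ} {l : Fin k} {T : ExtIdx k (q + 1)}
    (hl : l ∉ T.1) (f : ExtIdx k q → K) : ∑ S, extMulMatrix K k q l T S * f S = 0 := by
  refine Finset.sum_eq_zero fun S _ => ?_
  rw [extMulMatrix_apply, if_neg (fun h : T.1 = insert l S.1 => hl (h ▸ Finset.mem_insert_self l S.1)),
    zero_mul]

/-- Single nonzero term of `Σ_S L_{e_l}(T,S) f(S)`: the term `S = T ∖ l` if `l ∈ T`.
[cite: DerksenMakam2018, Prop 4.6 (proof)] -/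
theorem sum_extMulMatrix_mul_of_mem {k q : ℕ} {l : Fin k} {T : ExtIdx k (q + 1)} (hl : l ∈ T.1)
    (f : ExtIdx k q → K) :
    ∑ S, extMulMatrix K k q l T S * f S =
      wedgeSign K l (T.1.erase l) *
        f ⟨T.1.erase l, by rw [Finset.card_erase_of_mem hl, T.2]; rfl⟩ := by
  let S₀ : ExtIdx k q := ⟨T.1.erase l, by rw [Finset.card_erase_of_mem hl, T.2]; rfl⟩
  have hT : T.1 = insert l S₀.1 := (Finset.insert_erase hl).symm
  rw [Finset.sum_eq_single S₀]
  · rw [extMulMatrix_apply, if_pos hT]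
  · intro S _ hS
    rw [extMulMatrix_apply, if_neg, zero_mul]
    intro h
    apply hS
    apply Subtype.ext
    show S.1 = T.1.erase l
    rw [h, Finset.erase_insert (not_mem_of_eq_insert h)]
  · exact fun h => absurd (Finset.mem_univ _) h

/-- Vandermonde independence on a subset: if `Σ_{l ∈ T} c_l α_l^d = 0` for all `d < |T|` and the
`α_l`, `l ∈ T`, are distinct, then `c = 0` on `T`. [cite: DerksenMakam2018, Prop 4.6 (proof)] -/
theorem vandermonde_vecMul_eq_zero_of_injOn {ι : Type*} [DecidableEq ι] {N : ℕ} {T : Finset ι}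
    (hT : T.card = N) {α : ι → K} (hα : Set.InjOn α T) {c : ι → K}
    (h : ∀ d : Fin N, ∑ l ∈ T, c l * α l ^ (d : ℕ) = 0) : ∀ l ∈ T, c l = 0 := by
  classical
  have hcard : Fintype.card {l // l ∈ T} = N := by rw [Fintype.card_coe, hT]
  let e : {l // l ∈ T} ≃ Fin N := Fintype.equivFinOfCardEq hcard
  have hinj : Function.Injective (fun i : Fin N => α (e.symm i).1) := by
    intro i j hij
    have := hα (e.symm i).2 (e.symm j).2 hij
    exact e.symm.injective (Subtype.ext this)
  have hdet : (Matrix.vandermonde (fun i : Fin N => α (e.symm i).1)).det ≠ 0 :=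
    Matrix.det_vandermonde_ne_zero_iff.2 hinj
  have hvec : Matrix.vecMul (fun i : Fin N => c (e.symm i).1)
      (Matrix.vandermonde (fun i : Fin N => α (e.symm i).1)) = 0 := by
    funext d
    rw [Matrix.vecMul, dotProduct, Pi.zero_apply]
    simp only [Matrix.vandermonde_apply]
    rw [← h d, ← Finset.sum_coe_sort T]
    exact e.symm.sum_comp (fun l : {l // l ∈ T} => c l.1 * α l.1 ^ (d : ℕ))
  have hc := Matrix.eq_zero_of_vecMul_eq_zero hdet hvec
  intro l hl
  have := congr_fun hc (e ⟨l, hl⟩)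
  simpa using this

/-- Vandermonde independence, column form: if `Σ_b α_l^b y_b = 0` for all `l ∈ T`, `|T|` = length of
`y`, with distinct `α_l`, then `y = 0`. [cite: DerksenMakam2018, Prop 4.6 (proof)] -/
theorem vandermonde_mulVec_eq_zero_of_injOn {ι : Type*} [DecidableEq ι] {N : ℕ} {T : Finset ι}
    (hT : T.card = N) {α : ι → K} (hα : Set.InjOn α T) {y : Fin N → K}
    (h : ∀ l ∈ T, ∑ b : Fin N, α l ^ (b : ℕ) * y b = 0) : y = 0 := by
  classical
  have hcard : Fintype.card {l // l ∈ T} = N := by rw [Fintype.card_coe, hT]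
  let e : {l // l ∈ T} ≃ Fin N := Fintype.equivFinOfCardEq hcard
  have hinj : Function.Injective (fun i : Fin N => α (e.symm i).1) := by
    intro i j hij
    have := hα (e.symm i).2 (e.symm j).2 hij
    exact e.symm.injective (Subtype.ext this)
  have hdet : (Matrix.vandermonde (fun i : Fin N => α (e.symm i).1)).det ≠ 0 :=
    Matrix.det_vandermonde_ne_zero_iff.2 hinj
  refine Matrix.eq_zero_of_mulVec_eq_zero hdet ?_
  funext i
  rw [Matrix.mulVec, dotProduct, Pi.zero_apply]
  simp only [Matrix.vandermonde_apply]
  exact h _ (e.symm i).2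

/-- The rows of `F_{t,p} z` for the rank-one-slice tensor `t_{l,b,d} = α_l^d α_l^{p-b}`:
`(F z)(T, d) = Σ_{l ∈ T} ε(l, T∖l) β_l(T∖l) α_l^d` with `β_l(S) = Σ_b α_l^{p-b} z(S, b)`.
[cite: DerksenMakam2018, Prop 4.6 (proof)] -/
theorem koszulMatrix_rankOne_mulVec_apply (p : ℕ) (α : Fin (2 * p + 1) → K)
    (z : ExtIdx (2 * p + 1) p × Fin (p + 1) → K) (T : ExtIdx (2 * p + 1) (p + 1)) (d : Fin (p + 1)) :
    (koszulMatrix p (fun l (b d : Fin (p + 1)) => α l ^ (d : ℕ) * α l ^ (p - (b : ℕ))) *ᵥ z) (T, d) =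
      ∑ l ∈ T.1, (wedgeSign K l (T.1.erase l) *
        ∑ b : Fin (p + 1), α l ^ (p - (b : ℕ)) *
          (if h : (T.1.erase l).card = p then z (⟨T.1.erase l, h⟩, b) else 0)) * α l ^ (d : ℕ) := by
  classical
  rw [Matrix.mulVec, dotProduct, Fintype.sum_prod_type]
  have hentry : ∀ (S : ExtIdx (2 * p + 1) p) (b : Fin (p + 1)),
      koszulMatrix p (fun l (b d : Fin (p + 1)) => α l ^ (d : ℕ) * α l ^ (p - (b : ℕ))) (T, d) (S, b) *
        z (S, b) =
      ∑ l, extMulMatrix K (2 * p + 1) p l T S *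
        (α l ^ (d : ℕ) * (α l ^ (p - (b : ℕ)) * z (S, b))) := by
    intro S b
    rw [koszulMatrix_apply_eq, Finset.sum_mul]
    refine Finset.sum_congr rfl fun l _ => ?_
    simp only []
    ring
  rw [Finset.sum_congr rfl fun S _ => Finset.sum_congr rfl fun b _ => hentry S b]
  rw [Finset.sum_congr rfl fun S _ => Finset.sum_comm, Finset.sum_comm]
  -- now: ∑ l, ∑ S, ∑ b, L_l T S * (α l ^ d * (α l ^ (p - b) * z (S, b))) = RHS
  have hl : ∀ l : Fin (2 * p + 1), ∑ S : ExtIdx (2 * p + 1) p, ∑ b : Fin (p + 1),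
      extMulMatrix K (2 * p + 1) p l T S * (α l ^ (d : ℕ) * (α l ^ (p - (b : ℕ)) * z (S, b))) =
      if l ∈ T.1 then (wedgeSign K l (T.1.erase l) *
        ∑ b : Fin (p + 1), α l ^ (p - (b : ℕ)) *
          (if h : (T.1.erase l).card = p then z (⟨T.1.erase l, h⟩, b) else 0)) * α l ^ (d : ℕ)
      else 0 := by
    intro l
    have hfac : ∀ S : ExtIdx (2 * p + 1) p, ∑ b : Fin (p + 1),
        extMulMatrix K (2 * p + 1) p l T S * (α l ^ (d : ℕ) * (α l ^ (p - (b : ℕ)) * z (S, b))) =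
        extMulMatrix K (2 * p + 1) p l T S *
          (α l ^ (d : ℕ) * ∑ b : Fin (p + 1), α l ^ (p - (b : ℕ)) * z (S, b)) := by
      intro S
      rw [Finset.mul_sum, Finset.mul_sum]
    rw [Finset.sum_congr rfl fun S _ => hfac S]
    by_cases hlT : l ∈ T.1
    · rw [sum_extMulMatrix_mul_of_mem hlT, if_pos hlT]
      have hc : (T.1.erase l).card = p := by rw [Finset.card_erase_of_mem hlT, T.2]; rfl
      simp only [hc, dif_pos]
      ring
    · rw [sum_extMulMatrix_mul_of_not_mem hlT, if_neg hlT]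
  rw [Finset.sum_congr rfl fun l _ => hl l, Finset.sum_ite_mem, Finset.univ_inter]

/-- **Injectivity of `Σ_l L_{e_l} ⊗ v_l w_lᵀ` for the Vandermonde families `v_l = (α_l^d)_d`,
`w_l = (α_l^{p-b})_b`, `2p+1` distinct `α_l`** (Landsberg–Ottaviani's full-rank argument for the
Koszul flattening of a general rank-`(2p+1)` tensor, in coordinates): the `e_T`-row block only
involves the `p+1` independent vectors `v_l`, `l ∈ T`; then for each `p`-set `S` the `p+1`
independent vectors `w_l`, `l ∉ S`, force `z(S, ·) = 0`. [cite: DerksenMakam2018, Prop 4.6 (proof)] -/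
theorem koszulMatrix_rankOne_mulVec_eq_zero (p : ℕ) {α : Fin (2 * p + 1) → K}
    (hα : Function.Injective α) {z : ExtIdx (2 * p + 1) p × Fin (p + 1) → K}
    (hz : koszulMatrix p (fun l (b d : Fin (p + 1)) => α l ^ (d : ℕ) * α l ^ (p - (b : ℕ))) *ᵥ z = 0) :
    z = 0 := by
  classical
  -- Step 1: for every (p+1)-set `T` and `l ∈ T`: `β_l(T ∖ l) = 0`.
  have hβ : ∀ (T : ExtIdx (2 * p + 1) (p + 1)) (l : Fin (2 * p + 1)), l ∈ T.1 →
      ∑ b : Fin (p + 1), α l ^ (p - (b : ℕ)) *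
        (if h : (T.1.erase l).card = p then z (⟨T.1.erase l, h⟩, b) else 0) = 0 := by
    intro T
    have hrow : ∀ d : Fin (p + 1), ∑ l ∈ T.1, (wedgeSign K l (T.1.erase l) *
        ∑ b : Fin (p + 1), α l ^ (p - (b : ℕ)) *
          (if h : (T.1.erase l).card = p then z (⟨T.1.erase l, h⟩, b) else 0)) * α l ^ (d : ℕ) = 0 := by
      intro d
      rw [← koszulMatrix_rankOne_mulVec_apply p α z T d, hz, Pi.zero_apply]
    have hc := vandermonde_vecMul_eq_zero_of_injOn (K := K) T.2 hα.injOn hrow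
    intro l hl
    have h1 := hc l hl
    rcases mul_eq_zero.1 h1 with h1 | h1
    · exfalso
      have := wedgeSign_mul_self (R := K) l (T.1.erase l)
      rw [h1, zero_mul] at this
      exact zero_ne_one this
    · exact h1
  -- Step 2: for every p-set `S` and `l ∉ S`: `Σ_b α_l^{p-b} z(S, b) = 0`.
  have hS : ∀ (S : ExtIdx (2 * p + 1) p) (l : Fin (2 * p + 1)), l ∉ S.1 →
      ∑ b : Fin (p + 1), α l ^ (p - (b : ℕ)) * z (S, b) = 0 := by
    intro S l hl
    let T : ExtIdx (2 * p + 1) (p + 1) :=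
      ⟨insert l S.1, by rw [Finset.card_insert_of_notMem hl, S.2]⟩
    have h := hβ T l (Finset.mem_insert_self l S.1)
    have hTS : T.1.erase l = S.1 := Finset.erase_insert hl
    have hcard : (T.1.erase l).card = p := by rw [hTS, S.2]
    simp only [hcard, dif_pos] at h
    have hsub : (⟨T.1.erase l, hcard⟩ : ExtIdx (2 * p + 1) p) = S := Subtype.ext hTS
    rw [hsub] at h
    exact h
  -- Step 3: Vandermonde in `b`: `z(S, ·) = 0`.
  funext x
  rcases x with ⟨S, b⟩
  have hT' : (Finset.univ \ S.1).card = p + 1 := by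
    rw [Finset.card_univ_sdiff, S.2, Fintype.card_fin]
    omega
  have hy := vandermonde_mulVec_eq_zero_of_injOn (K := K) hT' hα.injOn
    (y := fun b' : Fin (p + 1) => z (S, Fin.rev b')) (fun l hl => by
      have hl' : l ∉ S.1 := (Finset.mem_sdiff.1 hl).2
      rw [← hS S l hl', ← Equiv.sum_comp Fin.revPerm (fun b => α l ^ (p - (b : ℕ)) * z (S, b))]
      refine Finset.sum_congr rfl fun b' _ => ?_
      simp only [Fin.revPerm_apply, Fin.val_rev]
      congr 2
      omega)
  have := congr_fun hy (Fin.rev b)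
  simp only [Fin.rev_rev, Pi.zero_apply] at this
  rw [Pi.zero_apply]
  exact this

/-- Full rank of the rank-one-slice Koszul matrix. [cite: DerksenMakam2018, Prop 4.6 (proof)] -/
theorem rank_koszulMatrix_rankOne (p : ℕ) {α : Fin (2 * p + 1) → K} (hα : Function.Injective α) :
    (koszulMatrix p (fun l (b d : Fin (p + 1)) => α l ^ (d : ℕ) * α l ^ (p - (b : ℕ)))).rank =
      Fintype.card (ExtIdx (2 * p + 1) p × Fin (p + 1)) := by
  have hinj : Function.Injective
      (koszulMatrix p (fun l (b d : Fin (p + 1)) => α l ^ (d : ℕ) * α l ^ (p - (b : ℕ)))).mulVecLin := by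
    rw [← LinearMap.ker_eq_bot, LinearMap.ker_eq_bot']
    intro z hz
    exact koszulMatrix_rankOne_mulVec_eq_zero p hα hz
  unfold Matrix.rank
  rw [LinearMap.finrank_range_of_inj hinj, Module.finrank_fintype_fun_eq_card]

/-- **[DM16, Prop 4.6] = [Landsberg 2015], second proof (characteristic `0`, via the Vandermonde
change of basis and the general-position criterion)**: Landsberg's matrix
`L_{e₁} ⊗ S_{−p} + ⋯ + L_{e_{2p+1}} ⊗ S_p` has full rank. (The named fact is discharged by name in
`DM16LandsbergMatrixProofs.lean`; this corollary is kept as the worked example of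
`rank_koszulMatrix_glAction` + `rank_koszulMatrix_rankOne`.) [cite: DerksenMakam2018, Prop 4.6] -/
theorem DerksenMakam2018_prop_4_6_viaKoszul (K : Type*) [Field K] [CharZero K] (p : ℕ) :
    DerksenMakam2018_prop_4_6 K p := by
  classical
  unfold DerksenMakam2018_prop_4_6
  let α : Fin (2 * p + 1) → K := fun l => ((l : ℕ) : K)
  have hα : Function.Injective α := fun l l' h => Fin.ext (Nat.cast_injective (R := K) h)
  rw [landsbergMatrix_eq_koszulMatrix]
  rcases Nat.eq_zero_or_pos p with rfl | hp
  · -- `p = 0`: the tensor already has rank-one slices (all entries are `1`)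
    have h : (fun (i : Fin (2 * 0 + 1)) (b d : Fin (0 + 1)) => toeplitzShift K 0 i d b) =
        fun l (b d : Fin (0 + 1)) => α l ^ (d : ℕ) * α l ^ (0 - (b : ℕ)) := by
      funext i b d
      simp [toeplitzShift]
    rw [h]
    exact rank_koszulMatrix_rankOne 0 hα
  · obtain ⟨p', rfl⟩ : ∃ p', p = p' + 1 := ⟨p - 1, by omega⟩
    have hdet : (Matrix.vandermonde α).det ≠ 0 := Matrix.det_vandermonde_ne_zero_iff.2 hα
    rw [← rank_koszulMatrix_glAction p' hdet, vandermondeAction_toeplitz]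
    exact rank_koszulMatrix_rankOne (p' + 1) hα

end Landsberg

end Literature.Computability.AlgebraicComplexity
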